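import Mathlib

/-!
# BirchSwinnertonDyer — rank ≥ 2 observatory: KERNEL-2DESC kill layer (A), the residue-insolubility
# search for a 2-covering `Q₁ = Q₂ = 0` of the cubic-field 2-descent, integers only

HONEST FRAMING: per-curve certified theorems and census instruments; no claim on BSD in rank ≥ 2.

Generic file of the KERNEL-2DESC v1.3a "kill" layer (design `b2b-bsdr2-cert-3/KERNEL-2DESC.md` §11).
Setting: `E : y² = F(x)`, `F` an irreducible monic integer cubic, `K = ℚ(α)` its cubic field with
`α³ + aα² + bα + c = 0`, `θ = t₀ + t₁α + t₂α²` a root of `F`, and `z = z₀ + z₁α + z₂α²` one of the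
classes admitted by the norm / sign sieve of the descent (`Rank2Observatory2DescVCover`). If a rational
point has `(x − θ)·z ∈ K²`, then `x − θ = z·ρ²` with `ρ = (r₀ + r₁α + r₂α²)/n`, and comparing the
`α`- and `α²`-coordinates of `n²(x − θ) = z·(r₀ + r₁α + r₂α²)²` gives an integer zero
`v = (r₀, r₁, r₂, n)`, primitive at any chosen prime `p`, of the pair of quadratic forms
`killQ = (Q₁, Q₂)` below (the 2-covering of the class `z` as an intersection of two quadrics in `ℙ³`).
This file is the INTEGER half of the certificate:

* `mul3`, `zsq`, `killQ` — computable arithmetic of `ℤ[α]` on the power basis and the two forms;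
* `check`, `killCheck` — the level-by-level search over residue vectors, chart-normalised (first
  coordinate prime to `p` scaled to `1`): a node `(v, M)` is DEAD when `killQ v ≢ 0 (mod M)`, else it
  is split into its `p³` children `v + M·d` (digits on the three free coordinates) with modulus `M·p`,
  while fuel lasts; the kernel evaluates it by `decide`;
* `killCheck_sound` — if `killCheck p … fuel = true` then `killQ` has NO integer zero primitive at `p`.

The proof is elementary: polynomial maps respect congruences (pushed through `ZMod M`), `killQ` is
homogeneous of degree `2`, a unit mod `p^N` normalises the chart coordinate, and base-`p` digits
descend the tree. No `p`-adic numbers occur. The number-field half (from `IsSquare ((x − θ)·z)` to a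
primitive zero, and the rank bound with one class removed) is `Rank2Observatory2DescKill`.

References: J. W. S. Cassels, *Lectures on Elliptic Curves* (1991), §15 (the `x − θ` map and its
image); D. Simon, Computing the rank of elliptic curves over number fields, LMS J. Comput. Math. 5
(2002) 7–17, §2 (the quadrics `q_z` attached to a class and their local solubility);
J. E. Cremona, *Algorithms for Modular Elliptic Curves* (1997), §3.6 (residue-disc recursion for local
solubility). [cite: Cassels1991LecturesEllipticCurves, §15] [cite: CremonaAlgorithms1997, §3.6]
-/

set_option linter.dupNamespace false

namespace Summit.BirchSwinnertonDyer.BirchSwinnertonDyer.Rank2Observatory.TwoDescKill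

/-! ### Computable arithmetic on the power basis -/

section Ring

variable {R : Type*} [CommRing R]

/-- Product of `u₀ + u₁α + u₂α²` and `v₀ + v₁α + v₂α²` in `R[α]/(α³ + aα² + bα + c)`, on the power
basis (`α³ = −aα² − bα − c`, `α⁴ = (a² − b)α² + (ab − c)α + ac`). [folklore] -/
def mul3 (a b c : R) (u v : R × R × R) : R × R × R :=
  let p3 := u.2.1 * v.2.2 + u.2.2 * v.2.1
  let p4 := u.2.2 * v.2.2
  (u.1 * v.1 - c * p3 + a * c * p4,
    u.1 * v.2.1 + u.2.1 * v.1 - b * p3 + (a * b - c) * p4,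
    u.1 * v.2.2 + u.2.1 * v.2.1 + u.2.2 * v.1 - a * p3 + (a * a - b) * p4)

/-- `z · (r₀ + r₁α + r₂α²)²` on the power basis. [folklore] -/
def zsq (a b c : R) (z r : R × R × R) : R × R × R := mul3 a b c z (mul3 a b c r r)

/-- The two quadratic forms of the 2-covering of the class `z` (`θ = t₀ + t₁α + t₂α²`):
`Q₁(v) = (z·r²)_α + t₁n²`, `Q₂(v) = (z·r²)_{α²} + t₂n²` at `v = (r₀, r₁, r₂, n)`.
[cite: Cassels1991LecturesEllipticCurves, §15] -/
def killQ (a b c : R) (z : R × R × R) (t₁ t₂ : R) (v : R × R × R × R) : R × R :=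
  let w := zsq a b c z (v.1, v.2.1, v.2.2.1)
  (w.2.1 + t₁ * v.2.2.2 ^ 2, w.2.2 + t₂ * v.2.2.2 ^ 2)

/-- The value `u₀ + u₁α + u₂α²` of a coordinate vector. [folklore] -/
def ev (α : R) (u : R × R × R) : R := u.1 + u.2.1 * α + u.2.2 * α ^ 2

/-- `mul3` is multiplication in `R[α]`. [folklore] -/
theorem ev_mul3 {a b c α : R} (hα : α ^ 3 + a * α ^ 2 + b * α + c = 0) (u v : R × R × R) :
    ev α (mul3 a b c u v) = ev α u * ev α v := by
  simp only [ev, mul3]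
  linear_combination (-(u.2.1 * v.2.2 + u.2.2 * v.2.1) - u.2.2 * v.2.2 * (α - a)) * hα

/-- `zsq` is `z · r²` in `R[α]`. [folklore] -/
theorem ev_zsq {a b c α : R} (hα : α ^ 3 + a * α ^ 2 + b * α + c = 0) (z r : R × R × R) :
    ev α (zsq a b c z r) = ev α z * ev α r ^ 2 := by
  simp only [zsq, ev_mul3 hα]; ring

/-- `mul3` commutes with ring maps. [folklore] -/
theorem map_mul3 {S : Type*} [CommRing S] (f : R →+* S) (a b c : R) (u v : R × R × R) :
    (f (mul3 a b c u v).1, f (mul3 a b c u v).2.1, f (mul3 a b c u v).2.2) =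
      mul3 (f a) (f b) (f c) (f u.1, f u.2.1, f u.2.2) (f v.1, f v.2.1, f v.2.2) := by
  simp only [mul3, map_add, map_sub, map_mul]

/-- `zsq` commutes with ring maps. [folklore] -/
theorem map_zsq {S : Type*} [CommRing S] (f : R →+* S) (a b c : R) (z r : R × R × R) :
    (f (zsq a b c z r).1, f (zsq a b c z r).2.1, f (zsq a b c z r).2.2) =
      zsq (f a) (f b) (f c) (f z.1, f z.2.1, f z.2.2) (f r.1, f r.2.1, f r.2.2) := by
  simp only [zsq, mul3, map_add, map_sub, map_mul]

/-- `killQ` commutes with ring maps. [folklore] -/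
theorem map_killQ {S : Type*} [CommRing S] (f : R →+* S) (a b c : R) (z : R × R × R) (t₁ t₂ : R)
    (v : R × R × R × R) :
    (f (killQ a b c z t₁ t₂ v).1, f (killQ a b c z t₁ t₂ v).2) =
      killQ (f a) (f b) (f c) (f z.1, f z.2.1, f z.2.2) (f t₁) (f t₂)
        (f v.1, f v.2.1, f v.2.2.1, f v.2.2.2) := by
  simp only [killQ, zsq, mul3, map_add, map_sub, map_mul, map_pow]

/-- `killQ` is homogeneous of degree `2`. [folklore] -/
theorem killQ_smul (a b c : R) (z : R × R × R) (t₁ t₂ l : R) (v : R × R × R × R) :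
    killQ a b c z t₁ t₂ (l * v.1, l * v.2.1, l * v.2.2.1, l * v.2.2.2) =
      (l ^ 2 * (killQ a b c z t₁ t₂ v).1, l ^ 2 * (killQ a b c z t₁ t₂ v).2) := by
  simp only [killQ, zsq, mul3]
  refine Prod.ext ?_ ?_ <;> (simp only; ring)

end Ring

/-! ### The search -/

/-- Add the digits `d₀, d₁, d₂` (times `M`) to the three coordinates other than the chart coordinate
`i ∈ {0, 1, 2, 3}`. [folklore] -/
def addDigits (i : ℕ) (v : ℤ × ℤ × ℤ × ℤ) (M : ℤ) (d₀ d₁ d₂ : ℕ) : ℤ × ℤ × ℤ × ℤ :=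
  match i with
  | 0 => (v.1, v.2.1 + M * d₀, v.2.2.1 + M * d₁, v.2.2.2 + M * d₂)
  | 1 => (v.1 + M * d₀, v.2.1, v.2.2.1 + M * d₁, v.2.2.2 + M * d₂)
  | 2 => (v.1 + M * d₀, v.2.1 + M * d₁, v.2.2.1, v.2.2.2 + M * d₂)
  | _ => (v.1 + M * d₀, v.2.1 + M * d₁, v.2.2.1 + M * d₂, v.2.2.2)

/-- The chart coordinate. [folklore] -/
def coord (i : ℕ) (v : ℤ × ℤ × ℤ × ℤ) : ℤ :=
  match i with
  | 0 => v.1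
  | 1 => v.2.1
  | 2 => v.2.2.1
  | _ => v.2.2.2

/-- A node `(v, M)` is dead when `killQ v ≢ (0, 0) (mod M)`. [folklore] -/
def dead (M : ℕ) (q : ℤ × ℤ) : Bool :=
  !(decide (q.1 % (M : ℤ) = 0) && decide (q.2 % (M : ℤ) = 0))

/-- The fuelled search below the node `(v, M)` in chart `i`: dead, or all `p³` children certified.
[cite: CremonaAlgorithms1997, §3.6] -/
def check (p : ℕ) (a b c : ℤ) (z : ℤ × ℤ × ℤ) (t₁ t₂ : ℤ) : ℕ → ℤ × ℤ × ℤ × ℤ → ℕ → ℕ → Bool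
  | 0, v, _, M => dead M (killQ a b c z t₁ t₂ v)
  | f + 1, v, i, M => dead M (killQ a b c z t₁ t₂ v) ||
      (List.range p).all fun d₀ => (List.range p).all fun d₁ => (List.range p).all fun d₂ =>
        check p a b c z t₁ t₂ f (addDigits i v M d₀ d₁ d₂) i (M * p)

/-- **The kill certificate**: every chart-normalised residue vector mod `p` (first coordinate prime to
`p` scaled to `1`) is certified by `check`. [cite: CremonaAlgorithms1997, §3.6] -/
def killCheck (p : ℕ) (a b c : ℤ) (z : ℤ × ℤ × ℤ) (t₁ t₂ : ℤ) (fuel : ℕ) : Bool :=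
  ((List.range p).all fun d₀ => (List.range p).all fun d₁ => (List.range p).all fun d₂ =>
      check p a b c z t₁ t₂ fuel (1, (d₀ : ℤ), (d₁ : ℤ), (d₂ : ℤ)) 0 p) &&
  ((List.range p).all fun d₁ => (List.range p).all fun d₂ =>
      check p a b c z t₁ t₂ fuel (0, 1, (d₁ : ℤ), (d₂ : ℤ)) 1 p) &&
  ((List.range p).all fun d₂ => check p a b c z t₁ t₂ fuel (0, 0, 1, (d₂ : ℤ)) 2 p) &&
  check p a b c z t₁ t₂ fuel (0, 0, 0, 1) 3 p

/-! ### Soundness -/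

/-- Congruent vectors have congruent `killQ`-values. [folklore] -/
theorem killQ_congr (a b c : ℤ) (z : ℤ × ℤ × ℤ) (t₁ t₂ : ℤ) (M : ℕ) {u v : ℤ × ℤ × ℤ × ℤ}
    (h₀ : (M : ℤ) ∣ u.1 - v.1) (h₁ : (M : ℤ) ∣ u.2.1 - v.2.1) (h₂ : (M : ℤ) ∣ u.2.2.1 - v.2.2.1)
    (h₃ : (M : ℤ) ∣ u.2.2.2 - v.2.2.2) :
    (M : ℤ) ∣ (killQ a b c z t₁ t₂ u).1 - (killQ a b c z t₁ t₂ v).1 ∧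
      (M : ℤ) ∣ (killQ a b c z t₁ t₂ u).2 - (killQ a b c z t₁ t₂ v).2 := by
  have e₀ := (ZMod.intCast_eq_intCast_iff_dvd_sub v.1 u.1 M).mpr h₀
  have e₁ := (ZMod.intCast_eq_intCast_iff_dvd_sub v.2.1 u.2.1 M).mpr h₁
  have e₂ := (ZMod.intCast_eq_intCast_iff_dvd_sub v.2.2.1 u.2.2.1 M).mpr h₂
  have e₃ := (ZMod.intCast_eq_intCast_iff_dvd_sub v.2.2.2 u.2.2.2 M).mpr h₃
  have hu := map_killQ (Int.castRingHom (ZMod M)) a b c z t₁ t₂ u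
  have hv := map_killQ (Int.castRingHom (ZMod M)) a b c z t₁ t₂ v
  simp only [eq_intCast] at hu hv
  rw [e₀, e₁, e₂, e₃, ← hu] at hv
  have hv' := Prod.mk.inj hv
  exact ⟨(ZMod.intCast_eq_intCast_iff_dvd_sub _ _ M).mp hv'.1,
    (ZMod.intCast_eq_intCast_iff_dvd_sub _ _ M).mp hv'.2⟩

/-- Base-`p` digit below a congruence: `M ∣ u − v ⇒ M·p ∣ u − (v + M d)` for some digit `d < p`. [folklore] -/
theorem exists_digit {p : ℕ} (hp : 0 < p) (M : ℕ) {u v : ℤ} (h : (M : ℤ) ∣ u - v) :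
    ∃ d : ℕ, d < p ∧ ((M * p : ℕ) : ℤ) ∣ u - (v + (M : ℤ) * (d : ℤ)) := by
  obtain ⟨q, hq⟩ := h
  have hp' : (0 : ℤ) < p := by exact_mod_cast hp
  have hq0 : 0 ≤ q % (p : ℤ) := Int.emod_nonneg _ hp'.ne'
  have hqp : q % (p : ℤ) < p := Int.emod_lt_of_pos _ hp'
  refine ⟨(q % (p : ℤ)).toNat, by omega, q / p, ?_⟩
  rw [Int.toNat_of_nonneg hq0]
  have hdiv := Int.emod_add_ediv_mul q (p : ℤ)
  push_cast
  linear_combination hq - (M : ℤ) * hdiv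

/-- A dead node has no zero of `killQ` modulo `M` congruent to it. [folklore] -/
theorem dead_sound {a b c : ℤ} {z : ℤ × ℤ × ℤ} {t₁ t₂ : ℤ} {M : ℕ} {v u : ℤ × ℤ × ℤ × ℤ}
    (hd : dead M (killQ a b c z t₁ t₂ v) = true)
    (h₀ : (M : ℤ) ∣ u.1 - v.1) (h₁ : (M : ℤ) ∣ u.2.1 - v.2.1) (h₂ : (M : ℤ) ∣ u.2.2.1 - v.2.2.1)
    (h₃ : (M : ℤ) ∣ u.2.2.2 - v.2.2.2) {N : ℤ} (hN : (M : ℤ) ∣ N)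
    (hz : N ∣ (killQ a b c z t₁ t₂ u).1 ∧ N ∣ (killQ a b c z t₁ t₂ u).2) : False := by
  obtain ⟨c₁, c₂⟩ := killQ_congr a b c z t₁ t₂ M h₀ h₁ h₂ h₃
  have d₁ : (M : ℤ) ∣ (killQ a b c z t₁ t₂ v).1 := by
    have := (hN.trans hz.1)
    have := Int.dvd_sub this c₁
    simpa using this
  have d₂ : (M : ℤ) ∣ (killQ a b c z t₁ t₂ v).2 := by
    have := (hN.trans hz.2)
    have := Int.dvd_sub this c₂
    simpa using this
  simp only [dead, Bool.not_eq_true', Bool.and_eq_false_iff, decide_eq_false_iff_not] at hd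
  rcases hd with hd | hd
  · exact hd (Int.emod_eq_zero_of_dvd d₁)
  · exact hd (Int.emod_eq_zero_of_dvd d₂)

/-- **Node soundness**: if `check … f v i M = true` (`0 < M`), then no integer vector `u` with the
same chart coordinate as `v` and `u ≡ v (mod M)` has `killQ u ≡ (0, 0) (mod M·p^f)`.
[cite: CremonaAlgorithms1997, §3.6] -/
theorem check_sound {p : ℕ} (hp : 0 < p) (a b c : ℤ) (z : ℤ × ℤ × ℤ) (t₁ t₂ : ℤ) :
    ∀ (f : ℕ) (v : ℤ × ℤ × ℤ × ℤ) (i M : ℕ), check p a b c z t₁ t₂ f v i M = true →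
      ∀ u : ℤ × ℤ × ℤ × ℤ, coord i u = coord i v →
        (M : ℤ) ∣ u.1 - v.1 → (M : ℤ) ∣ u.2.1 - v.2.1 → (M : ℤ) ∣ u.2.2.1 - v.2.2.1 →
        (M : ℤ) ∣ u.2.2.2 - v.2.2.2 →
        ¬ (((M * p ^ f : ℕ) : ℤ) ∣ (killQ a b c z t₁ t₂ u).1 ∧
            ((M * p ^ f : ℕ) : ℤ) ∣ (killQ a b c z t₁ t₂ u).2)
  | 0, v, i, M, h, u, hc, h₀, h₁, h₂, h₃, hz => by
      refine dead_sound (M := M) (by simpa [check] using h) h₀ h₁ h₂ h₃ ?_ hz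
      simp
  | f + 1, v, i, M, h, u, hc, h₀, h₁, h₂, h₃, hz => by
      simp only [check, Bool.or_eq_true, List.all_eq_true, List.mem_range] at h
      rcases h with hd | hall
      · exact dead_sound (M := M) hd h₀ h₁ h₂ h₃ ⟨(p : ℤ) ^ (f + 1), by push_cast; ring⟩ hz
      · have hmod : ((M * p * p ^ f : ℕ) : ℤ) = ((M * p ^ (f + 1) : ℕ) : ℤ) := by push_cast; ring
        -- digits of the three free coordinates
        have key : ∀ (w₀ w₁ w₂ v₀ v₁ v₂ : ℤ), (M : ℤ) ∣ w₀ - v₀ → (M : ℤ) ∣ w₁ - v₁ → (M : ℤ) ∣ w₂ - v₂ →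
            ∃ d₀ d₁ d₂ : ℕ, d₀ < p ∧ d₁ < p ∧ d₂ < p ∧
              ((M * p : ℕ) : ℤ) ∣ w₀ - (v₀ + (M : ℤ) * d₀) ∧ ((M * p : ℕ) : ℤ) ∣ w₁ - (v₁ + (M : ℤ) * d₁) ∧
                ((M * p : ℕ) : ℤ) ∣ w₂ - (v₂ + (M : ℤ) * d₂) := by
          intro w₀ w₁ w₂ v₀ v₁ v₂ g₀ g₁ g₂
          obtain ⟨d₀, hd₀, e₀⟩ := exists_digit hp M g₀
          obtain ⟨d₁, hd₁, e₁⟩ := exists_digit hp M g₁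
          obtain ⟨d₂, hd₂, e₂⟩ := exists_digit hp M g₂
          exact ⟨d₀, d₁, d₂, hd₀, hd₁, hd₂, e₀, e₁, e₂⟩
        have hfix : ((M * p : ℕ) : ℤ) ∣ coord i u - coord i v := by rw [hc, sub_self]; exact dvd_zero _
        match i, hc, hfix with
        | 0, hc, hfix =>
            obtain ⟨d₀, d₁, d₂, hd₀, hd₁, hd₂, e₀, e₁, e₂⟩ := key _ _ _ _ _ _ h₁ h₂ h₃
            have ih := check_sound hp a b c z t₁ t₂ f (addDigits 0 v M d₀ d₁ d₂) 0 (M * p)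
              (hall d₀ hd₀ d₁ hd₁ d₂ hd₂) u (by simpa [coord, addDigits] using hc)
              (by simpa [addDigits, coord] using hfix) (by simpa [addDigits] using e₀)
              (by simpa [addDigits] using e₁) (by simpa [addDigits] using e₂)
            rw [hmod] at ih
            exact ih hz
        | 1, hc, hfix =>
            obtain ⟨d₀, d₁, d₂, hd₀, hd₁, hd₂, e₀, e₁, e₂⟩ := key _ _ _ _ _ _ h₀ h₂ h₃
            have ih := check_sound hp a b c z t₁ t₂ f (addDigits 1 v M d₀ d₁ d₂) 1 (M * p)
              (hall d₀ hd₀ d₁ hd₁ d₂ hd₂) u (by simpa [coord, addDigits] using hc)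
              (by simpa [addDigits] using e₀) (by simpa [addDigits, coord] using hfix)
              (by simpa [addDigits] using e₁) (by simpa [addDigits] using e₂)
            rw [hmod] at ih
            exact ih hz
        | 2, hc, hfix =>
            obtain ⟨d₀, d₁, d₂, hd₀, hd₁, hd₂, e₀, e₁, e₂⟩ := key _ _ _ _ _ _ h₀ h₁ h₃
            have ih := check_sound hp a b c z t₁ t₂ f (addDigits 2 v M d₀ d₁ d₂) 2 (M * p)
              (hall d₀ hd₀ d₁ hd₁ d₂ hd₂) u (by simpa [coord, addDigits] using hc)
              (by simpa [addDigits] using e₀) (by simpa [addDigits] using e₁)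
              (by simpa [addDigits, coord] using hfix) (by simpa [addDigits] using e₂)
            rw [hmod] at ih
            exact ih hz
        | k + 3, hc, hfix =>
            obtain ⟨d₀, d₁, d₂, hd₀, hd₁, hd₂, e₀, e₁, e₂⟩ := key _ _ _ _ _ _ h₀ h₁ h₂
            have ih := check_sound hp a b c z t₁ t₂ f (addDigits (k + 3) v M d₀ d₁ d₂) (k + 3) (M * p)
              (hall d₀ hd₀ d₁ hd₁ d₂ hd₂) u (by simpa [coord, addDigits] using hc)
              (by simpa [addDigits] using e₀) (by simpa [addDigits] using e₁)
              (by simpa [addDigits] using e₂) (by simpa [addDigits, coord] using hfix)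
            rw [hmod] at ih
            exact ih hz

/-- **Soundness of the kill certificate**: if `killCheck p … fuel = true` for a prime `p`, then
`killQ` has no integer zero that is primitive at `p`. [cite: CremonaAlgorithms1997, §3.6] -/
theorem killCheck_sound {p : ℕ} (hp : p.Prime) {a b c : ℤ} {z : ℤ × ℤ × ℤ} {t₁ t₂ : ℤ} {fuel : ℕ}
    (h : killCheck p a b c z t₁ t₂ fuel = true) (v : ℤ × ℤ × ℤ × ℤ)
    (hprim : ¬ ((p : ℤ) ∣ v.1 ∧ (p : ℤ) ∣ v.2.1 ∧ (p : ℤ) ∣ v.2.2.1 ∧ (p : ℤ) ∣ v.2.2.2))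
    (h0 : killQ a b c z t₁ t₂ v = 0) : False := by
  have hp0 : 0 < p := hp.pos
  have hpZ : Prime (p : ℤ) := Nat.prime_iff_prime_int.mp hp
  simp only [killCheck, Bool.and_eq_true, List.all_eq_true, List.mem_range] at h
  obtain ⟨⟨⟨hc0, hc1⟩, hc2⟩, hc3⟩ := h
  -- the modulus of the leaves and a unit normalising a coordinate prime to `p`
  set N : ℕ := p * p ^ fuel with hN
  have unit_of : ∀ w : ℤ, ¬ (p : ℤ) ∣ w → ∃ l m : ℤ, l * w + m * (N : ℤ) = 1 := by
    intro w hw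
    have hcop : IsCoprime w ((p : ℤ) ^ (fuel + 1)) :=
      ((Prime.coprime_iff_not_dvd hpZ).mpr hw).symm.pow_right
    obtain ⟨l, m, hlm⟩ := hcop
    exact ⟨l, m, by rw [hN]; push_cast; linear_combination hlm⟩
  -- residues mod p as digits
  have digit : ∀ w : ℤ, ∃ d : ℕ, d < p ∧ (p : ℤ) ∣ w - d := by
    intro w
    have hp' : (0 : ℤ) < p := by exact_mod_cast hp0
    refine ⟨(w % (p : ℤ)).toNat, ?_, w / p, ?_⟩
    · have := Int.emod_lt_of_pos w hp'; have := Int.emod_nonneg w hp'.ne'; omega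
    · rw [Int.toNat_of_nonneg (Int.emod_nonneg w hp'.ne')]
      linear_combination (-1 : ℤ) * Int.emod_add_ediv_mul w (p : ℤ)
  -- the scaled vector `u = l • v` with the chart coordinate replaced by `1` is a zero mod `N`
  have scaled : ∀ (l m w : ℤ), l * w + m * (N : ℤ) = 1 → ∀ u : ℤ × ℤ × ℤ × ℤ,
      (N : ℤ) ∣ u.1 - l * v.1 → (N : ℤ) ∣ u.2.1 - l * v.2.1 → (N : ℤ) ∣ u.2.2.1 - l * v.2.2.1 →
      (N : ℤ) ∣ u.2.2.2 - l * v.2.2.2 →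
      ((p * p ^ fuel : ℕ) : ℤ) ∣ (killQ a b c z t₁ t₂ u).1 ∧
        ((p * p ^ fuel : ℕ) : ℤ) ∣ (killQ a b c z t₁ t₂ u).2 := by
    intro l m w _ u g₀ g₁ g₂ g₃
    have hc := killQ_congr a b c z t₁ t₂ N (v := (l * v.1, l * v.2.1, l * v.2.2.1, l * v.2.2.2))
      g₀ g₁ g₂ g₃
    rw [killQ_smul, h0] at hc
    simpa [hN] using hc
  by_cases hv0 : (p : ℤ) ∣ v.1
  · by_cases hv1 : (p : ℤ) ∣ v.2.1
    · by_cases hv2 : (p : ℤ) ∣ v.2.2.1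
      · -- chart 3
        have hv3 : ¬ (p : ℤ) ∣ v.2.2.2 := fun h3 => hprim ⟨hv0, hv1, hv2, h3⟩
        obtain ⟨l, m, hlm⟩ := unit_of _ hv3
        have hz := scaled l m _ hlm (l * v.1, l * v.2.1, l * v.2.2.1, 1) (by simp) (by simp) (by simp)
          ⟨m, by linear_combination -hlm⟩
        refine check_sound hp0 a b c z t₁ t₂ fuel (0, 0, 0, 1) 3 p hc3 (l * v.1, l * v.2.1, l * v.2.2.1, 1)
          rfl ?_ ?_ ?_ (by simp) hz
        · simpa using (dvd_mul_of_dvd_right hv0 l)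
        · simpa using (dvd_mul_of_dvd_right hv1 l)
        · simpa using (dvd_mul_of_dvd_right hv2 l)
      · -- chart 2
        obtain ⟨l, m, hlm⟩ := unit_of _ hv2
        obtain ⟨d₂, hd₂, e₂⟩ := digit (l * v.2.2.2)
        have hz := scaled l m _ hlm (l * v.1, l * v.2.1, 1, l * v.2.2.2) (by simp) (by simp)
          ⟨m, by linear_combination -hlm⟩ (by simp)
        refine check_sound hp0 a b c z t₁ t₂ fuel (0, 0, 1, (d₂ : ℤ)) 2 p (hc2 d₂ hd₂)
          (l * v.1, l * v.2.1, 1, l * v.2.2.2) rfl ?_ ?_ (by simp) (by simpa using e₂) hz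
        · simpa using (dvd_mul_of_dvd_right hv0 l)
        · simpa using (dvd_mul_of_dvd_right hv1 l)
    · -- chart 1
      obtain ⟨l, m, hlm⟩ := unit_of _ hv1
      obtain ⟨d₁, hd₁, e₁⟩ := digit (l * v.2.2.1)
      obtain ⟨d₂, hd₂, e₂⟩ := digit (l * v.2.2.2)
      have hz := scaled l m _ hlm (l * v.1, 1, l * v.2.2.1, l * v.2.2.2) (by simp)
        ⟨m, by linear_combination -hlm⟩ (by simp) (by simp)
      refine check_sound hp0 a b c z t₁ t₂ fuel (0, 1, (d₁ : ℤ), (d₂ : ℤ)) 1 p (hc1 d₁ hd₁ d₂ hd₂)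
        (l * v.1, 1, l * v.2.2.1, l * v.2.2.2) rfl ?_ (by simp) (by simpa using e₁) (by simpa using e₂) hz
      simpa using (dvd_mul_of_dvd_right hv0 l)
  · -- chart 0
    obtain ⟨l, m, hlm⟩ := unit_of _ hv0
    obtain ⟨d₀, hd₀, e₀⟩ := digit (l * v.2.1)
    obtain ⟨d₁, hd₁, e₁⟩ := digit (l * v.2.2.1)
    obtain ⟨d₂, hd₂, e₂⟩ := digit (l * v.2.2.2)
    have hz := scaled l m _ hlm (1, l * v.2.1, l * v.2.2.1, l * v.2.2.2)
      ⟨m, by linear_combination -hlm⟩ (by simp) (by simp) (by simp)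
    exact check_sound hp0 a b c z t₁ t₂ fuel (1, (d₀ : ℤ), (d₁ : ℤ), (d₂ : ℤ)) 0 p
      (hc0 d₀ hd₀ d₁ hd₁ d₂ hd₂) (1, l * v.2.1, l * v.2.2.1, l * v.2.2.2) rfl (by simp)
      (by simpa using e₀) (by simpa using e₁) (by simpa using e₂) hz

end Summit.BirchSwinnertonDyer.BirchSwinnertonDyer.Rank2Observatory.TwoDescKill
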